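import Summits.PneNP.PneNP.Theorems.ConvexRankGatesLinAlgGateBlindFacetSubst
import Summits.PneNP.PneNP.Theorems.ConvexRankGatesLinAlgGateBlindFacetTransport
import Summits.PneNP.PneNP.Theorems.LinAlgGateBlind.Negative.DetGate
import Literature.LinearAlgebra.Matrix.RankMinors

/-!
# Route ConvexRankGates, crux `LinAlgGateBlind` (stmt-PneNP-10681): facet count for linear pencils, V — the count

Support theorems for the crux (vocabulary of `Theorems/ConvexRankGatesLinAlgGateBlindDefs.lean`); fifth file of the
facet count for linear pencils, assembling `…FacetKernel` (Cramer kernel vectors, specialisation), `…FacetSubst`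
(one-step closure), `…FacetTrdeg`/`…FacetTransport` (potential and transport). For `K : ι → F^{d×d}` and
`W ⊆ ι` put `M_W := ∑_{i ∈ W} Xᵢ Kᵢ ∈ F[X]^{d×d}`; a FACET is a maximal `W` with `det M_W = 0`.

* `exists_facet_code` — **encoding of facets.** Every facet `W` is determined by a short code
  `(ρ, γ, D)`: `r = rank M_W < d` rows `ρ`, `r+1` columns `γ` and a set `D ⊆ W` with `#D ≤ 2d - 1`, through
  `W = Ŵ(ρ, γ, D) := {i : K_i u = ∑_{j∈D} c_j K_j u for some c_j ∈ Frac F[X]}`, `u = u_D` the Cramer vector of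
  `M_D` on `(ρ, γ)`. Proof: choose `(ρ, γ')` carrying a non-zero `r`-minor of `M_W`, a fresh column `b₀`,
  `γ = b₀ ∷ γ'`, and `D₀ =` the variables of one monomial of that minor (`#D₀ ≤ r`); for `D₀ ⊆ D ⊆ W` the Cramer
  vector `u_D` is a non-zero kernel vector of `M_D` (all `(r+1)`-minors vanish below `W`) and specialises along
  `D ⊆ D'`. With the potential `t(D) = trdeg F[u_D] ≤ d` take `D` maximising `t` among
  `{D₀ ⊆ D ⊆ W, #D ≤ #D₀ + t(D)}`: for `i ∈ W` failing the criterion, `t(D+i) > t(D)` by transport and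
  monotonicity, contradicting maximality; so `W ⊆ Ŵ(D)`, and `Ŵ(D)` is singular by one-step closure, whence
  `W = Ŵ(D)` by maximality of the facet.
* `card_facets_le` — **THE FACET COUNT**: a family of facets has at most `d^{2d} · ∑_{k < 2d} C(#ι, k)` members
  (`≤ (d (#ι + 1))^{2d}`), for every field, every `d` and every configuration `K`.

Through the facet cover `sgAt_of_facet_budget` this lifts the general `GRANK_s` door of the crux from the live-span
cover exponent `s²` to `O(s log(ns))` (sequel). Sources: the argument is the tree's (rigidity of linear pencils);
generic matrices: Edmonds 1967 §5. No new definitions. [folklore]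
-/

-- `Summit.PneNP.PneNP.…` duplicates `PneNP` BY DESIGN (single-problem summit).
set_option linter.dupNamespace false

namespace Summit.PneNP.PneNP.Theorems

open Finset Matrix MvPolynomial Literature.LinearAlgebra.Matrix
open Summit.PneNP.PneNP.Theorems.LinAlgGateBlind.Negative

section Count

open scoped Classical

variable {F : Type*} [Field F] {ι : Type*} [Fintype ι] [DecidableEq ι] {d : ℕ}

/-- **Encoding of facets by short codes.** Let `W` be a facet of the configuration `K : ι → F^{d×d}` (a maximal
`W` with `det (∑_{i∈W} Xᵢ Kᵢ) = 0`). Then there are `r < d`, rows `ρ : Fin r → Fin d`, columns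
`γ : Fin (r+1) → Fin d` and `D ⊆ ι` with `#D ≤ 2d - 1` such that `W` is EXACTLY the set of indices `i` whose matrix
acts on the Cramer vector `u_D` of `M_D = ∑_{j∈D} X_j K_j` on `(ρ, γ)` like an element of the pencil of `D` over
`Frac F[X]`: `K_i u_D = ∑_{j ∈ D} c_j K_j u_D`. (Greedy potential argument on `t(D) = trdeg_F F[u_D] ≤ d` with
transport `exists_coeff_of_trdeg_eq`, closure `det_pencil_union_eq_zero_of_kernel`, and maximality; see the module
docstring.) The code is packaged as one element `code = (⟨r, (ρ, γ)⟩, D)` of a finite type. [folklore] -/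
theorem exists_facet_code : ∀ {F : Type*} [Field F] {ι : Type*} [Fintype ι] [DecidableEq ι] {d : ℕ}
    (K : ι → Matrix (Fin d) (Fin d) F) (W : Finset ι),
    Maximal (fun W : Finset ι =>
      (∑ j ∈ W, (X j : MvPolynomial ι F) • (K j).map (C : F →+* MvPolynomial ι F)).det = 0) W →
    ∃ code : (Σ r : Fin d, (Fin r → Fin d) × (Fin (r + 1) → Fin d)) × Finset ι, #code.2 ≤ 2 * d - 1 ∧
      W = univ.filter fun i => ∃ c : ι → FractionRing (MvPolynomial ι F),
        ((K i).map ((algebraMap (MvPolynomial ι F) (FractionRing (MvPolynomial ι F))).comp C) -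
            ∑ j ∈ code.2, c j •
              (K j).map ((algebraMap (MvPolynomial ι F) (FractionRing (MvPolynomial ι F))).comp C))
          *ᵥ (fun b => algebraMap (MvPolynomial ι F) (FractionRing (MvPolynomial ι F))
            (∑ k : Fin (code.1.1 + 1), if code.1.2.2 k = b then (-1 : MvPolynomial ι F) ^ (k : ℕ) *
              ((∑ j ∈ code.2, (X j : MvPolynomial ι F) • (K j).map (C : F →+* MvPolynomial ι F)).submatrix
                code.1.2.1 (code.1.2.2 ∘ Fin.succAbove k)).det else 0)) = 0 := by
  intro F _ ι _ _ d K W hW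
  classical
  -- notation
  set L := FractionRing (MvPolynomial ι F) with hL
  set φ : MvPolynomial ι F →+* L := algebraMap (MvPolynomial ι F) L with hφ
  have hφinj : Function.Injective φ := IsFractionRing.injective (MvPolynomial ι F) L
  set M : Finset ι → Matrix (Fin d) (Fin d) (MvPolynomial ι F) :=
    fun D => ∑ j ∈ D, (X j : MvPolynomial ι F) • (K j).map (C : F →+* MvPolynomial ι F) with hM
  set kill : Finset ι → (MvPolynomial ι F →ₐ[F] MvPolynomial ι F) :=
    fun S => MvPolynomial.aeval fun k => if k ∈ S then (X k : MvPolynomial ι F) else 0 with hkill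
  have hkillM : ∀ {D S : Finset ι}, S ⊆ D → (M D).map (kill S) = M S := fun h =>
    pencil_map_kill_of_superset K h
  have hkill_minor : ∀ {D S : Finset ι}, S ⊆ D → ∀ {κ : Type} [Fintype κ] [DecidableEq κ] (ρ' γ' : κ → Fin d),
      kill S ((M D).submatrix ρ' γ').det = ((M S).submatrix ρ' γ').det := by
    intro D S h κ _ _ ρ' γ'
    rw [AlgHom.map_det, AlgHom.mapMatrix_apply, ← Matrix.submatrix_map, hkillM h]
  -- rank data of the facet over the fraction field
  have hWdet : (M W).det = 0 := hW.1
  set MW : Matrix (Fin d) (Fin d) L := (M W).map φ with hMW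
  have hdetMW : MW.det = 0 := by
    rw [hMW, ← RingHom.mapMatrix_apply, ← RingHom.map_det, hWdet, map_zero]
  set r : ℕ := MW.rank with hr
  have hrd : r < d := by
    by_contra h
    exact (le_rank_iff_det_ne_zero MW).1 (not_lt.1 h) hdetMW
  obtain ⟨ρ, γ', hminor⟩ := (le_rank_iff_exists_det_submatrix_ne_zero MW).1 (le_refl r)
  have hvan : ∀ ρ'' γ'' : Fin (r + 1) → Fin d, (MW.submatrix ρ'' γ'').det = 0 :=
    (rank_le_iff_det_submatrix_eq_zero MW).1 (le_refl r)
  have hmapminor : ∀ {κ : Type} [Fintype κ] [DecidableEq κ] (ρ' γ' : κ → Fin d),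
      (MW.submatrix ρ' γ').det = φ (((M W).submatrix ρ' γ').det) := by
    intro κ _ _ ρ' γ'
    rw [hMW, Matrix.submatrix_map, RingHom.map_det, RingHom.mapMatrix_apply]
  have hminorR : ((M W).submatrix ρ γ').det ≠ 0 := fun h0 => hminor (by rw [hmapminor, h0, map_zero])
  have hvanR : ∀ {D : Finset ι}, D ⊆ W → ∀ ρ'' γ'' : Fin (r + 1) → Fin d,
      ((M D).submatrix ρ'' γ'').det = 0 := by
    intro D hD ρ'' γ''
    have h1 : ((M W).submatrix ρ'' γ'').det = 0 := hφinj (by rw [← hmapminor, hvan, map_zero])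
    rw [← hkill_minor hD, h1, map_zero]
  -- a fresh column `b₀` and the column selection `γ = b₀ ∷ γ'`
  obtain ⟨b₀, hb₀⟩ : ∃ b₀ : Fin d, b₀ ∉ univ.image γ' := by
    by_contra h
    have h1 : (univ : Finset (Fin d)) ⊆ univ.image γ' := fun b _ => by
      by_contra hb
      exact h ⟨b, hb⟩
    have h2 := (card_le_card h1).trans card_image_le
    simp only [card_univ, Fintype.card_fin] at h2
    omega
  set γ : Fin (r + 1) → Fin d := Fin.cons b₀ γ' with hγ
  have hγ0 : γ 0 = b₀ := by simp [hγ]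
  have hγsucc : ∀ k : Fin r, γ k.succ = γ' k := fun k => by simp [hγ]
  have hγne : ∀ k : Fin r, γ k.succ ≠ γ 0 := fun k h =>
    hb₀ (by rw [← hγ0, ← h, hγsucc]; exact mem_image_of_mem γ' (mem_univ k))
  -- Cramer vectors
  set u : Finset ι → Fin d → MvPolynomial ι F := fun D b => ∑ k : Fin (r + 1), if γ k = b then
    (-1 : MvPolynomial ι F) ^ (k : ℕ) * ((M D).submatrix ρ (γ ∘ Fin.succAbove k)).det else 0 with hu
  have hkerD : ∀ {D : Finset ι}, D ⊆ W → M D *ᵥ u D = 0 := fun hD =>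
    mulVec_cramerVec_eq_zero (M _) ρ γ (hvanR hD)
  have hkill_u : ∀ {D D' : Finset ι}, D ⊆ D' → ∀ b, kill D (u D' b) = u D b := by
    intro D D' h b
    simp only [hu]
    rw [show (kill D) (∑ k : Fin (r + 1), if γ k = b then
        (-1 : MvPolynomial ι F) ^ (k : ℕ) * ((M D').submatrix ρ (γ ∘ Fin.succAbove k)).det else 0) =
        (kill D : MvPolynomial ι F →+* MvPolynomial ι F) (∑ k : Fin (r + 1), if γ k = b then
        (-1 : MvPolynomial ι F) ^ (k : ℕ) * ((M D').submatrix ρ (γ ∘ Fin.succAbove k)).det else 0) from rfl,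
      map_cramerVec]
    refine Finset.sum_congr rfl fun k _ => ?_
    rw [RingHom.coe_coe, hkillM h]
  have hhead : ∀ D : Finset ι, u D b₀ = ((M D).submatrix ρ γ').det := by
    intro D
    have h := cramerVec_apply_head (M D) ρ γ hγne
    rw [hγ0] at h
    simp only [hu]
    have hγ' : γ ∘ Fin.succ = γ' := funext hγsucc
    rw [h, hγ']
  -- the starting set `D₀`: the variables of a monomial of the non-zero minor
  set Q : MvPolynomial ι F := ((M W).submatrix ρ γ').det with hQ
  obtain ⟨α, hα⟩ := MvPolynomial.support_nonempty.2 hminorR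
  set D₀ : Finset ι := α.support with hD₀
  have hD₀W : D₀ ⊆ W := by
    have hQW : kill W Q = Q := hkill_minor (subset_refl W) ρ γ'
    exact support_subset_of_mem_support_kill W Q (by rw [hQW]; exact hα)
  have hD₀card : #D₀ ≤ r := by
    simpa using card_support_le_of_mem_support_det K W ρ γ' hα
  have hune : ∀ {D : Finset ι}, D₀ ⊆ D → D ⊆ W → u D ≠ 0 := by
    intro D hD₀D hDW h0
    have h1 : u D b₀ = kill D Q := by rw [hhead, hQ, hkill_minor hDW]
    have h2 : kill D Q ≠ 0 := kill_ne_zero_of_mem_support D Q hα hD₀D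
    exact h2 (by rw [← h1, h0, Pi.zero_apply])
  -- the potential
  set t : Finset ι → ℕ := fun D => Cardinal.toNat (Algebra.trdeg F (Algebra.adjoin F (Set.range (u D))))
    with ht
  have htfin : ∀ D : Finset ι, Algebra.trdeg F (Algebra.adjoin F (Set.range (u D))) < Cardinal.aleph0 :=
    fun D => (trdeg_adjoin_range_le_card (F := F) (u D)).trans_lt Cardinal.natCast_lt_aleph0
  have htle : ∀ D : Finset ι, t D ≤ d := fun D => by
    have h := Cardinal.toNat_le_toNat (trdeg_adjoin_range_le_card (F := F) (u D)) Cardinal.natCast_lt_aleph0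
    simpa [ht] using h
  have htmono : ∀ {D D' : Finset ι}, D ⊆ D' → t D ≤ t D' := fun {D D'} h =>
    Cardinal.toNat_le_toNat (trdeg_adjoin_range_comp_le (kill D) (u D') (u D) (hkill_u h)) (htfin D')
  -- transport
  have htransport : ∀ {D : Finset ι}, D ⊆ W → ∀ i ∈ W, i ∉ D → t D = t (insert i D) →
      ∃ c : ι → L, ((K i).map (φ.comp C) - ∑ j ∈ D, c j • (K j).map (φ.comp C)) *ᵥ
        (fun b => φ (u D b)) = 0 := by
    intro D hDW i hiW hiD hteq
    refine exists_coeff_of_trdeg_eq K D i hiD (u (insert i D)) (u D)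
      (fun b => (hkill_u (subset_insert i D) b).symm) (hkerD (insert_subset hiW hDW)) ?_ (htfin D)
    exact (Cardinal.toNat_inj_of_lt_aleph0 (htfin D) (htfin _)).1 hteq
  -- the greedy set: maximise the potential
  set 𝒟 : Finset (Finset ι) := W.powerset.filter fun D => D₀ ⊆ D ∧ #D ≤ #D₀ + t D with h𝒟
  have hD₀mem : D₀ ∈ 𝒟 := mem_filter.2 ⟨mem_powerset.2 hD₀W, subset_refl _, Nat.le_add_right _ _⟩
  obtain ⟨D, hD𝒟, hDmax⟩ := exists_max_image 𝒟 t ⟨D₀, hD₀mem⟩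
  obtain ⟨hDW', hD₀D, hDcard⟩ := mem_filter.1 hD𝒟
  have hDW : D ⊆ W := mem_powerset.1 hDW'
  have hcritW : ∀ i ∈ W, ∃ c : ι → L, ((K i).map (φ.comp C) - ∑ j ∈ D, c j • (K j).map (φ.comp C)) *ᵥ
      (fun b => φ (u D b)) = 0 := by
    intro i hiW
    by_cases hiD : i ∈ D
    · refine ⟨fun j => if j = i then 1 else 0, ?_⟩
      have hsum : ∑ j ∈ D, (if j = i then (1 : L) else 0) • (K j).map (φ.comp C) = (K i).map (φ.comp C) := by
        rw [Finset.sum_eq_single_of_mem i hiD (fun j _ hj => by rw [if_neg hj, zero_smul]), if_pos rfl,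
          one_smul]
      rw [hsum, sub_self, Matrix.zero_mulVec]
    · by_contra hcrit
      have hne : t D ≠ t (insert i D) := fun h => hcrit (htransport hDW i hiW hiD h)
      have hlt : t D < t (insert i D) := lt_of_le_of_ne (htmono (subset_insert i D)) hne
      have hmem' : insert i D ∈ 𝒟 := by
        refine mem_filter.2 ⟨mem_powerset.2 (insert_subset hiW hDW), hD₀D.trans (subset_insert i D), ?_⟩
        rw [card_insert_of_notMem hiD]
        omega
      exact absurd (hDmax _ hmem') (not_le.2 hlt)
  -- closure: the decoded set is singular, hence equal to the facet
  set Wh : Finset ι := univ.filter fun i => ∃ c : ι → L,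
    ((K i).map (φ.comp C) - ∑ j ∈ D, c j • (K j).map (φ.comp C)) *ᵥ (fun b => φ (u D b)) = 0 with hWh
  have hWWh : W ⊆ Wh := fun i hi => mem_filter.2 ⟨mem_univ i, hcritW i hi⟩
  have hWhsing : (M Wh).det = 0 := by
    have h := det_pencil_union_eq_zero_of_kernel φ hφinj K D Wh (u D) (hune hD₀D hDW) (hkerD hDW)
      (fun i hi => (mem_filter.1 hi).2)
    rwa [union_eq_right.2 (hDW.trans hWWh)] at h
  have hWeq : W = Wh := Subset.antisymm hWWh (hW.2 hWhsing hWWh)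
  refine ⟨(⟨⟨r, hrd⟩, (ρ, γ)⟩, D), ?_, hWeq⟩
  have h1 := htle D
  change #D ≤ 2 * d - 1
  omega

/-- **THE FACET COUNT.** For every field `F`, dimension `d`, finite index type `ι` and configuration
`K : ι → F^{d×d}`, every family of FACETS — maximal sets `W ⊆ ι` with `det (∑_{i ∈ W} Xᵢ Kᵢ) = 0` — has at most
`d^{2d} · ∑_{k < 2d} C(#ι, k)` members: the code `(r, ρ, γ, D)` of `exists_facet_code` determines the facet, and
there are at most `∑_{r<d} d^r d^{r+1} ≤ d^{2d}` triples `(r, ρ, γ)` and `∑_{k ≤ 2d-1} C(#ι, k)` sets `D`.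
[folklore] -/
theorem card_facets_le : ∀ {F : Type*} [Field F] {ι : Type*} [Fintype ι] [DecidableEq ι] {d : ℕ}
    (K : ι → Matrix (Fin d) (Fin d) F) (𝓕 : Finset (Finset ι)),
    (∀ W ∈ 𝓕, Maximal (fun W : Finset ι =>
      (∑ j ∈ W, (X j : MvPolynomial ι F) • (K j).map (C : F →+* MvPolynomial ι F)).det = 0) W) →
    #𝓕 ≤ d ^ (2 * d) * ∑ k ∈ range (2 * d), (Fintype.card ι).choose k := by
  intro F _ ι _ _ d K 𝓕 h𝓕
  classical
  -- dimension `0`: no facets at all (`det` of the empty matrix is `1`)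
  rcases Nat.eq_zero_or_pos d with hd | hd
  · subst hd
    have h0 : 𝓕 = ∅ := eq_empty_of_forall_notMem fun W hW => by
      have h := (h𝓕 W hW).1
      simp only [Matrix.det_isEmpty, one_ne_zero] at h
    simp [h0]
  -- the code of a facet
  haveI : Nonempty ((Σ r : Fin d, (Fin r → Fin d) × (Fin (r + 1) → Fin d)) × Finset ι) :=
    ⟨(⟨⟨0, hd⟩, (Fin.elim0, fun _ => ⟨0, hd⟩)⟩, ∅)⟩
  have hcode := fun W (hW : W ∈ 𝓕) => exists_facet_code K W (h𝓕 W hW)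
  choose! code hcodecard hWeq using hcode
  set Codes : Finset ((Σ r : Fin d, (Fin r → Fin d) × (Fin (r + 1) → Fin d)) × Finset ι) :=
    univ ×ˢ ((univ : Finset ι).powerset.filter fun D => #D ≤ 2 * d - 1) with hCodes
  have hmaps : ∀ W ∈ 𝓕, code W ∈ Codes := fun W hW =>
    mem_product.2 ⟨mem_univ _, mem_filter.2 ⟨mem_powerset.2 (subset_univ _), hcodecard W hW⟩⟩
  have hinj : Set.InjOn code 𝓕 := by
    intro W₁ hW₁ W₂ hW₂ h
    rw [hWeq W₁ hW₁, hWeq W₂ hW₂, h]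
  -- count the codes
  calc #𝓕 ≤ #Codes := card_le_card_of_injOn code hmaps hinj
    _ = Fintype.card (Σ r : Fin d, (Fin r → Fin d) × (Fin (r + 1) → Fin d)) *
          #((univ : Finset ι).powerset.filter fun D => #D ≤ 2 * d - 1) := by
        rw [hCodes, card_product, card_univ]
    _ ≤ d ^ (2 * d) * ∑ k ∈ range (2 * d), (Fintype.card ι).choose k := by
        gcongr
        · -- `∑_{r<d} d^r d^{r+1} ≤ d^{2d}`
          rw [Fintype.card_sigma]
          simp only [Fintype.card_prod, Fintype.card_fun, Fintype.card_fin]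
          calc ∑ r : Fin d, d ^ (r : ℕ) * d ^ ((r : ℕ) + 1) ≤ ∑ _r : Fin d, d ^ (d - 1) * d ^ d := by
                refine sum_le_sum fun r _ => Nat.mul_le_mul ?_ ?_
                · exact Nat.pow_le_pow_right hd (by omega)
                · exact Nat.pow_le_pow_right hd (by omega)
            _ = d ^ (2 * d) := by
                rw [sum_const, card_univ, Fintype.card_fin, smul_eq_mul, ← mul_assoc, ← pow_succ',
                  Nat.sub_add_cancel hd, ← pow_add, two_mul]
        · -- the sets `D` with `#D ≤ 2d-1`
          calc #((univ : Finset ι).powerset.filter fun D => #D ≤ 2 * d - 1)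
                ≤ #((range (2 * d)).biUnion fun k => powersetCard k (univ : Finset ι)) := by
                  refine card_le_card fun D hD => ?_
                  rw [mem_filter] at hD
                  refine mem_biUnion.2 ⟨#D, mem_range.2 ?_, mem_powersetCard.2 ⟨subset_univ _, rfl⟩⟩
                  omega
            _ ≤ ∑ k ∈ range (2 * d), #(powersetCard k (univ : Finset ι)) := card_biUnion_le
            _ = ∑ k ∈ range (2 * d), (Fintype.card ι).choose k := by
                  simp only [card_powersetCard, card_univ]

end Count

end Summit.PneNP.PneNP.Theorems
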